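import Summits.QuantumFields.YangMills.Theorems.IR.BlockedActivityUnivShellCond
import Summits.QuantumFields.YangMills.Theorems.IR.AfPincerUcFormat
import HarnessLib

/-!
# Crux `IR` (stmt-QuantumFields-19354), lane B «strong coupling AFTER BLOCKING»: the Typ-RELATIVISED blocked-activity class and its
# adapter to clause (i) of format Uc (owner R95 ∕ R98 (3): «the Typ-relativised variant is the preferred end-state»)

Helper module for item `stmt-QuantumFields-19354` (`--supports`; it closes nothing), lane `ym-19354-onsetsc-p2`.  Third file of the lane's
currency (`Theorems/IR/BlockedActivityDefs` p527934, `…UnivShellCond` p528785): the σ-UNIFORM class `BlockedActivityClass` is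
complete-analyticity strength and EXPOSED to a uniform wire; here the activity bound and the representation are demanded ONLY for exterior
data in a cell-local class `Typ` — the currency of format Uc's clause (i) (`FixedMesh.ClauseI`, `AfPincerUc.ClauseIAll`) and of the crux-plan
desk's hereditary activity-supplier shape (6d) `AfPincerUc.SharpOnset.ir_of_activitySupplierHereditarySharpSC` (cplan port rev 2 71577857bd55b2bd).

* `BlockedRepOn ρ β w Y a S` — the data of `BlockedRep` (σ-independent reference space, cell σ-algebras, perturbed cells, cell factors,
  realisation of centre observables) with `IsLocalPerturbation … (g σ) a` and the representation `∫ f dγ_Y^σ = pertExpect μ (g σ) (obs f) C`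
  asked only for `σ ∈ S`; `blockedRepOn_of_blockedRep` (uniform ⇒ relative to every `S`).
* `TypicalOff n Y Typ` — the data typical off `Y` on window+shell (the pairs compared by clause (i)).
* `BlockedActivityTyp ρ β w n a Typ` (ONE frame: every cell region of the `n`-window ∋ centre admits a `BlockedRepOn … (TypicalOff n Y Typ)`),
  `BlockedActivityTypAll` (at every centre: shifted frames `shiftFrame w c₀`, re-indexed class) — the `Act` of (6d).
* ADAPTERS (the Kotecký–Preiss step relativised, tree `norm_pertExpect_sub_integral_le'`, `Δ = 81`):
  `BlockedRepOn.norm_integral_sub_ref_le`, `BlockedRepOn.abs_integral_sub_integral_le` (two data in `S` move the centre expectation by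
  `≤ 4 e a 2⁸¹ (2e)⁸²`), **`clauseI_of_blockedActivityTyp : BlockedActivityTyp ρ β w n a Typ → ε ≤ 1 → a ≤ radius ε → ClauseI ρ β w n ε Typ`**
  (the agreement hypothesis of (i) is not used), **`clauseIAll_of_blockedActivityTypAll`**, `clauseI_mono`, the total radius
  `radiusT ε = radius (min ε 1)` and **`clauseIAll_of_blockedActivityTypAll_radiusT : BlockedActivityTypAll ρ β w n (radiusT ε) Typ →
  ClauseIAll ρ β w n ε Typ`** — exactly the `hadapt` of (6d) with `Act := BlockedActivityTypAll`, `r₀ n ε := radiusT ε`, no side condition;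
  `blockedActivityTyp_of_blockedActivityClass` (uniform class ⇒ relativised class at every frame and `Typ`).
The instantiated (6d) chain «Typ-relativised, NT-calibrated lane-B construction statement ⇒ I♯_SC ⇒ `IR|SC`» lives with the SharpOnset
glue (`Theorems/IR/BlockedActivityOnsetCal`).

HONEST FRAMING: an interface and adapters among OPEN statements of a CONDITIONAL chain; no blocked-activity bound is claimed for Yang–Mills at
any `β`; whether a boundary-layer-sensitive `Typ` with small RELATIVE activities exists at `b(β) ≍ ξ(β)` is the research content; not a gap,
not Clay.  No `sorry`; axioms ⊆ {propext, Classical.choice, Quot.sound}; no instances, no notation.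
Refs: FriedliVelenik2017 §5.7.1; OsterwalderSeilerAnnPhys1978 §3; DobrushinShlosman1985 (clause (i) = finite-size mixing among typical data).
-/

set_option autoImplicit false

noncomputable section

open MeasureTheory
open Literature.MathematicalPhysics.QuantumFieldTheory Literature.MathematicalPhysics.QuantumLattice
open Literature.Probability.LatticeModels (IsLocalPerturbation IsLocalObservable pertExpect)
open Summit.QuantumFields.YangMills.Cruxes.IR.Tempered (cellEdges windowCells regionEdges)
open Summit.QuantumFields.YangMills.Cruxes.IR.ShellTempered (windowCellsPlus)
open Summit.QuantumFields.YangMills.Cruxes.IR.OnsetFormats (UnivShellCond)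
open Summit.QuantumFields.YangMills.Cruxes.IR.FixedMesh (ClauseI)
open Summit.QuantumFields.YangMills.Cruxes.IR.AfPincerUc (ClauseIAll IsFrame)
open Summit.QuantumFields.YangMills.Cruxes.IR.CellTempered.Engine (shiftFrame)

namespace Summit.QuantumFields.YangMills.Cruxes.IR.BlockedActivity

section Defs

variable {G : Type} [Group G] [TopologicalSpace G] [IsTopologicalGroup G] [CompactSpace G]
  [MeasurableSpace G] [BorelSpace G]

/-- **Blocked local-perturbation representation RELATIVE TO A SET `S` OF EXTERIOR DATA**: the data of `BlockedRep` (σ-independent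
reference space, cell σ-algebras, perturbed cells, cell factors, realisation of centre observables), with the smallness ∕ locality of the
cell factors and the representation of the kernel expectations demanded ONLY for exterior data `σ ∈ S`.  (`BlockedRep` is the case
`S = univ`, `blockedRepOn_of_blockedRep`.) -/
structure BlockedRepOn {N : ℕ} (ρ : G →* Matrix (Fin N) (Fin N) ℂ) (β : ℝ) (w : Fin 4 → ℤ → ℤ)
    (Y : Finset Cell) (a : ℝ) (S : Set (LGConfig 4 G)) : Type 1 where
  /-- the reference sample space -/
  Ω : Type
  /-- its σ-algebra -/
  mΩ : MeasurableSpace Ω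
  /-- the reference (decoupled) probability measure -/
  μ : Measure Ω
  /-- it is a probability measure -/
  isProb : IsProbabilityMeasure μ
  /-- the local σ-algebras of the blocked cells -/
  𝓕 : Cell → MeasurableSpace Ω
  /-- the perturbed cells -/
  C : Finset Cell
  /-- the cell factors under an exterior datum -/
  g : LGConfig 4 G → Cell → Ω → ℂ
  /-- the realisation of centre observables on the reference space -/
  obs : (LGConfig 4 G → ℝ) → Ω → ℂ
  /-- smallness and locality of the cell factors, finite-range dependence of the reference — for data in `S` -/
  perturbation : ∀ σ ∈ S, IsLocalPerturbation μ CellAdj 𝓕 (g σ) a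
  /-- centre observables are realised as cell-`0`-local observables of norm `≤ 1` -/
  obs_local : ∀ f, IsCentreObs w f → IsLocalObservable 𝓕 (obs f) {0} 1
  /-- the representation of centre-cell kernel expectations as perturbed expectations — for data in `S` -/
  rep : ∀ σ ∈ S, ∀ f, IsCentreObs w f →
    ((∫ U, f U ∂(ymSpecification ρ β (regionEdges w Y) σ) : ℝ) : ℂ) = pertExpect μ (g σ) (obs f) C

/-- The exterior data TYPICAL OFF `Y` on window+shell for the cell-local class `Typ` (the pairs compared by clause (i)). -/
def TypicalOff (n : ℕ) (Y : Finset Cell) (Typ : Cell → Set (LGConfig 4 G)) : Set (LGConfig 4 G) :=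
  {σ | ∀ c ∈ windowCellsPlus n, c ∉ Y → σ ∈ Typ c}

/-- **The Typ-relativised blocked-activity class at ONE frame** (`Act` of the format's hereditary supplier shape): every cell region of the
`n`-window containing the centre admits a blocked representation of radius `a` relative to the data typical off the region. -/
def BlockedActivityTyp {N : ℕ} (ρ : G →* Matrix (Fin N) (Fin N) ℂ) (β : ℝ) (w : Fin 4 → ℤ → ℤ) (n : ℕ) (a : ℝ)
    (Typ : Cell → Set (LGConfig 4 G)) : Prop :=
  ∀ Y : Finset Cell, Y ⊆ windowCells n → (0 : Cell) ∈ Y → Nonempty (BlockedRepOn ρ β w Y a (TypicalOff n Y Typ))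

/-- … AT EVERY CENTRE (shifted frames, re-indexed class), the shape consumed by `AfPincerUc.ClauseIAll`. -/
def BlockedActivityTypAll {N : ℕ} (ρ : G →* Matrix (Fin N) (Fin N) ℂ) (β : ℝ) (w : Fin 4 → ℤ → ℤ) (n : ℕ) (a : ℝ)
    (Typ : Cell → Set (LGConfig 4 G)) : Prop :=
  ∀ c₀ : Cell, BlockedActivityTyp ρ β (shiftFrame w c₀) n a (fun c => Typ (c + c₀))

end Defs

/-! ## Adapters -/

section Adapters

variable {G : Type} [Group G] [TopologicalSpace G] [IsTopologicalGroup G] [CompactSpace G]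
  [MeasurableSpace G] [BorelSpace G] {N : ℕ} {ρ : G →* Matrix (Fin N) (Fin N) ℂ} {β : ℝ}
  {w : Fin 4 → ℤ → ℤ} {Y : Finset Cell} {a ε : ℝ} {S : Set (LGConfig 4 G)}

/-- A uniform representation is a representation relative to every set of data. -/
def blockedRepOn_of_blockedRep (R : BlockedRep ρ β w Y a) (S : Set (LGConfig 4 G)) : BlockedRepOn ρ β w Y a S where
  Ω := R.Ω
  mΩ := R.mΩ
  μ := R.μ
  isProb := R.isProb
  𝓕 := R.𝓕
  C := R.C
  g := R.g
  obs := R.obs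
  perturbation := fun σ _ => R.perturbation σ
  obs_local := R.obs_local
  rep := fun σ _ => R.rep σ

/-- **The Kotecký–Preiss step, relativised**: for data `σ ∈ S` the centre-cell kernel expectation is within `2 e a 2⁸¹ (2e)⁸²` of the
σ-independent reference value (tree `norm_pertExpect_sub_integral_le'`, `S = {0}`, `B = 1`, `Δ = 81`). -/
theorem BlockedRepOn.norm_integral_sub_ref_le (R : BlockedRepOn ρ β w Y a S)
    (h1 : Real.exp 1 * a * ((81 : ℝ) + 1) ^ 2 ≤ 1 / 2) (h2 : Real.exp 1 * a * 2 ^ 81 ≤ 1)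
    {σ : LGConfig 4 G} (hσ : σ ∈ S) {f : LGConfig 4 G → ℝ} (hf : IsCentreObs w f) :
    ‖((∫ U, f U ∂(ymSpecification ρ β (regionEdges w Y) σ) : ℝ) : ℂ) - ∫ ω, R.obs f ω ∂(R.μ)‖ ≤
      2 * Real.exp 1 * a * 2 ^ 81 * (2 * Real.exp 1) ^ 82 := by
  letI := R.mΩ
  haveI := R.isProb
  have h := Literature.Probability.LatticeModels.norm_pertExpect_sub_integral_le' (R := CellAdj) (nbr := cellNbr) (Δ := 81)
    cellAdj_symm card_cellNbr_le mem_cellNbr_of_cellAdj (R.perturbation σ hσ) (R.obs_local f hf) (by exact_mod_cast h1) h2 R.C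
  rw [Finset.card_singleton] at h
  rw [R.rep σ hσ f hf]
  refine h.trans (le_of_eq ?_)
  norm_num

/-- Two data in `S` move the centre-cell kernel expectation by at most `4 e a 2⁸¹ (2e)⁸²`. -/
theorem BlockedRepOn.abs_integral_sub_integral_le (R : BlockedRepOn ρ β w Y a S)
    (h1 : Real.exp 1 * a * ((81 : ℝ) + 1) ^ 2 ≤ 1 / 2) (h2 : Real.exp 1 * a * 2 ^ 81 ≤ 1)
    {σ σ' : LGConfig 4 G} (hσ : σ ∈ S) (hσ' : σ' ∈ S) {f : LGConfig 4 G → ℝ} (hf : IsCentreObs w f) :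
    |(∫ U, f U ∂(ymSpecification ρ β (regionEdges w Y) σ)) - ∫ U, f U ∂(ymSpecification ρ β (regionEdges w Y) σ')| ≤
      4 * Real.exp 1 * a * 2 ^ 81 * (2 * Real.exp 1) ^ 82 := by
  have hA := R.norm_integral_sub_ref_le h1 h2 hσ hf
  have hB := R.norm_integral_sub_ref_le h1 h2 hσ' hf
  set E : ℂ := ((∫ U, f U ∂(ymSpecification ρ β (regionEdges w Y) σ) : ℝ) : ℂ) with hE
  set E' : ℂ := ((∫ U, f U ∂(ymSpecification ρ β (regionEdges w Y) σ') : ℝ) : ℂ) with hE'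
  set I : ℂ := ∫ ω, R.obs f ω ∂(R.μ) with hI
  have hdiff : ‖E - E'‖ ≤ 4 * Real.exp 1 * a * 2 ^ 81 * (2 * Real.exp 1) ^ 82 := by
    calc ‖E - E'‖ = ‖(E - I) - (E' - I)‖ := by ring_nf
      _ ≤ ‖E - I‖ + ‖E' - I‖ := norm_sub_le _ _
      _ ≤ 2 * Real.exp 1 * a * 2 ^ 81 * (2 * Real.exp 1) ^ 82 +
            2 * Real.exp 1 * a * 2 ^ 81 * (2 * Real.exp 1) ^ 82 := add_le_add hA hB
      _ = _ := by ring
  have hreal : ‖E - E'‖ = |(∫ U, f U ∂(ymSpecification ρ β (regionEdges w Y) σ)) -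
      ∫ U, f U ∂(ymSpecification ρ β (regionEdges w Y) σ')| := by
    rw [hE, hE', ← Complex.ofReal_sub, Complex.norm_real, Real.norm_eq_abs]
  rw [← hreal]
  exact hdiff

/-- **Adapter: the Typ-relativised class at radius `a ≤ a(ε)` gives clause (i)** `FixedMesh.ClauseI ρ β w n ε Typ` (`ε ≤ 1`): two data
typical off `Y` are both within half the bound of the common reference value; the agreement hypothesis of (i) is not used. -/
theorem clauseI_of_blockedActivityTyp {n : ℕ} {Typ : Cell → Set (LGConfig 4 G)} (hC : BlockedActivityTyp ρ β w n a Typ)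
    (hε1 : ε ≤ 1) (haε : a ≤ radius ε) : ClauseI ρ β w n ε Typ := by
  intro Y hY h0 σ σ' htyp _ f hf hfm hf01
  obtain ⟨R⟩ := hC Y hY h0
  obtain ⟨h1, h2, h3⟩ := smallness_radius hε1
  have ha0 : 0 ≤ a := (R.perturbation σ fun c hc hcY => (htyp c hc hcY).1).nonneg
  have h1' : Real.exp 1 * a * ((81 : ℝ) + 1) ^ 2 ≤ 1 / 2 :=
    (mul_le_mul_of_nonneg_right (mul_le_mul_of_nonneg_left haε (Real.exp_pos 1).le) (by positivity)).trans h1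
  have h2' : Real.exp 1 * a * 2 ^ 81 ≤ 1 :=
    (mul_le_mul_of_nonneg_right (mul_le_mul_of_nonneg_left haε (Real.exp_pos 1).le) (by positivity)).trans h2
  have h3' : 4 * Real.exp 1 * a * 2 ^ 81 * (2 * Real.exp 1) ^ 82 ≤ ε := by
    calc 4 * Real.exp 1 * a * 2 ^ 81 * (2 * Real.exp 1) ^ 82
        ≤ 4 * Real.exp 1 * radius ε * 2 ^ 81 * (2 * Real.exp 1) ^ 82 := by gcongr
      _ ≤ ε := h3
  exact (R.abs_integral_sub_integral_le h1' h2' (fun c hc hcY => (htyp c hc hcY).1) (fun c hc hcY => (htyp c hc hcY).2)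
    ⟨hf, hfm, hf01⟩).trans h3'

/-- **Adapter AT EVERY CENTRE**: `BlockedActivityTypAll ρ β w n a Typ → ClauseIAll ρ β w n ε Typ` for `a ≤ a(ε)`, `ε ≤ 1` — the `hadapt`
of `AfPincerUc.SharpOnset.ir_of_activitySupplierHereditarySharpSC` with `Act := BlockedActivityTypAll`, `r₀ n ε := radius ε`. -/
theorem clauseIAll_of_blockedActivityTypAll {n : ℕ} {Typ : Cell → Set (LGConfig 4 G)} (hC : BlockedActivityTypAll ρ β w n a Typ)
    (hε1 : ε ≤ 1) (haε : a ≤ radius ε) : ClauseIAll ρ β w n ε Typ :=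
  fun c₀ => clauseI_of_blockedActivityTyp (hC c₀) hε1 haε

/-- The uniform class gives the relativised class at every frame and every `Typ`. -/
theorem blockedActivityTyp_of_blockedActivityClass {b n : ℕ} (hC : BlockedActivityClass ρ β b n a) (hw : IsFrame b w)
    (Typ : Cell → Set (LGConfig 4 G)) : BlockedActivityTyp ρ β w n a Typ := fun Y hY h0 => by
  obtain ⟨R⟩ := hC w hw Y hY h0
  exact ⟨blockedRepOn_of_blockedRep R _⟩

/-- Clause (i) is monotone in the accuracy. -/
theorem clauseI_mono {n : ℕ} {Typ : Cell → Set (LGConfig 4 G)} {ε ε' : ℝ} (h : ε ≤ ε') (hC : ClauseI ρ β w n ε Typ) :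
    ClauseI ρ β w n ε' Typ :=
  fun Y hY h0 σ σ' htyp hagree f hf hfm hf01 => (hC Y hY h0 σ σ' htyp hagree f hf hfm hf01).trans h

/-- The TOTAL radius `a₁(ε) = a(min ε 1)` (so that the adapter needs no side condition on `ε`). -/
def radiusT (ε : ℝ) : ℝ := radius (min ε 1)

/-- The total radius is positive for positive `ε`. -/
theorem radiusT_pos (hε : 0 < ε) : 0 < radiusT ε := radius_pos (lt_min hε one_pos)

/-- For `ε ≤ 1` the total radius is the radius. -/
theorem radiusT_eq_of_le_one (hε : ε ≤ 1) : radiusT ε = radius ε := by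
  unfold radiusT; rw [min_eq_left hε]

/-- **Adapter AT EVERY CENTRE, total form** (`hadapt` of `AfPincerUc.SharpOnset.ir_of_activitySupplierHereditarySharpSC` with
`Act := BlockedActivityTypAll`, `r₀ n ε := radiusT ε`, NO side condition): `BlockedActivityTypAll ρ β w n (radiusT ε) Typ → ClauseIAll ρ β w n ε Typ`. -/
theorem clauseIAll_of_blockedActivityTypAll_radiusT {n : ℕ} {Typ : Cell → Set (LGConfig 4 G)}
    (hC : BlockedActivityTypAll ρ β w n (radiusT ε) Typ) : ClauseIAll ρ β w n ε Typ :=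
  fun c₀ => clauseI_mono (min_le_left ε 1) (clauseI_of_blockedActivityTyp (hC c₀) (min_le_right ε 1) le_rfl)

end Adapters

end Summit.QuantumFields.YangMills.Cruxes.IR.BlockedActivity

end
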